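import Literature.NumberTheory.NumberFields.ChevalleyUnitCongruenceProofs
import Mathlib.RingTheory.DedekindDomain.SelmerGroup
import Mathlib.GroupTheory.Archimedean
import HarnessLib

/-!
# Chevalley 1951, Théorème 1 for the `{v}`-units of a number field, in congruence-depth form
(pure proofs; companion to `ChevalleyUnitCongruenceProofs`)

`ChevalleyUnitCongruenceProofs` discharges Chevalley's Théorème 1 (C. Chevalley, *Deux théorèmes
d'arithmétique*, J. Math. Soc. Japan **3** (1951) 36–44 [ChevalleyDeuxTheoremes1951]) for the unit
group `E = 𝓞_Kˣ`.  This file proves, **by the same argument**, the case of the group of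
`{v}`-units `E = {x ∈ Kˣ : |x|_u = 1 for all finite u ≠ v}` of a finite place `v` (a finitely
generated group: `E = 𝓞_Kˣ · π₀^ℤ`, `exists_generator_vUnits`), in the form in which
Jacquet–Langlands use it (LNM 114 (1970), proof of Lemma 12.5: idèle class characters trivial at
`v` and highly ramified at finitely many other places), namely as a statement about congruence
depths:

* `Chevalley1951.vUnits_valuation_sub_one_le` — for finite places `w ≠ v`, a finite set `S₀` of
  finite places and `m ∈ ℕ` there is a finite set `T` of finite places, disjoint from `S₀`, such
  that every `{v}`-unit `x` with `x ≡ 1 (mod 𝔭_t)` for all `t ∈ T` satisfies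
  `x ≡ 1 (mod 𝔭_w^m)`, i.e. `|x - 1|_w ≤ q_w^{-m}`.

This is Théorème 1 for `E` and the exponent `n = #(𝓞_K/𝔭_w^m)ˣ` (every `n`-th power of a
`{v}`-unit is `≡ 1 (mod 𝔭_w^m)`), and the proof is Chevalley's, step for step, reusing the
tree's inputs for the unit case:

1. **Prime-power exponents, modulo roots of unity** (`vUnits_exists_places_primePow`; Chevalley
   §5 and pp. 39–40): with `n = p^{f+2}`, `L` the splitting field of
   `(X^n - 1)(X^n - π₀) ∏_g (X^n - g)` (`g` over a generator of `μ(K)` and a fundamental system of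
   units), `ζ ∈ L` a primitive `n`-th root of unity: for each `σ ∈ Gal(L/K)` Chebotarev
   (`Chevalley1951.exists_prime_absNorm_isArithFrobAt_not_mem`, a theorem of the tree) gives a
   place `t_σ` off `S ∪ {v} ∪ {u ∣ p}` and `𝔔_σ ∣ t_σ` with Frobenius `σ`; `T = {t_σ}`.  If
   `x ∈ E ∩ 𝓞_K` is `≡ 1 (mod t_σ)` for all `σ`, every `σ ∈ Gal(L/K(ζ))` fixes an `n`-th root
   `y ∈ 𝓞_L` of `x` (`smul_eq_self_of_isArithFrobAt'`, the computation of Chevalley p. 39 for an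
   integer `x` prime to `𝔔` instead of a unit), so `y ∈ K(ζ)` and the descent of §4
   (`Chevalley1951.exists_eq_pow_or_eq_neg_pow_of_mem_adjoin`, a theorem of the tree) gives
   `x = ± w^{p^{f+1}}`.
2. **Arbitrary exponents, modulo roots of unity** (`vUnits_exists_places_nat`; §2): Bezout
   (`Chevalley1951.exists_torsion_mul_pow_of_coprime`).
3. **Killing the roots of unity and reading off the depth** (`vUnits_valuation_sub_one_le`): an
   auxiliary place `t₀ ∉ S₀ ∪ {v, w}` of residue characteristic `> #μ(K)`
   (`exists_place_forall_natCast_not_mem`) is added to `T`, and step 2 is used with exponent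
   `#(𝓞_K/𝔭_w^m)ˣ · #(𝓞_K/𝔭_{t₀})ˣ`: `x = ξ w^{Xc₀}`, `w^{c₀} ≡ 1 (mod t₀)` forces
   `ξ ≡ 1 (mod t₀)`, so `ξ = 1` (`Chevalley1951.eq_one_of_pow_eq_one_of_sub_one_mem`), and
   `(w^{c₀})^X ≡ 1 (mod 𝔭_w^m)`.  Non-integral `{v}`-units are inverted first (`E = 𝓞_Kˣ π₀^ℤ`
   with `π₀ ∈ 𝓞_K`; the statement is symmetric under `x ↦ x⁻¹`).

Theorems only: no `sorry`, no new definition, no new named fact (D-0026).  Used by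
`Automorphic/PiOfArtinRepHeckeTheoryOnlyProofs` to remove the hypothesis `Chev` of
`Automorphic.frobSatakeCompatibleAt_of_isPiOfArtinRep_both_of_chevalley`.

## References

* C. Chevalley, *Deux théorèmes d'arithmétique*, J. Math. Soc. Japan 3 (1951) 36–44,
  Théorème 1 (p. 36) and its proof §§1–5 (pp. 36–40). [ChevalleyDeuxTheoremes1951]
* H. Jacquet, R. P. Langlands, *Automorphic Forms on GL(2)*, LNM 114 (1970), Lemma 12.5.
  [JacquetLanglands1970]
* J. Tate, *Global class field theory*, Ch. VII of Cassels–Fröhlich (1967), §2.4 (Chebotarev).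
  [TateGCFT1967]
-/

noncomputable section

open NumberField IsDedekindDomain Polynomial

open scoped Classical IntermediateField NumberField

namespace Literature.NumberTheory.NumberFields

/-! ### Valuation helpers -/

section Valuation

variable {K : Type*} [Field K] [NumberField K]

/-- An element of `K` all of whose finite valuations are `≤ 1` is an algebraic integer. [folklore] -/
theorem Chevalley1951.exists_ringOfIntegers_eq_of_valuation_le_one {x : K}
    (h : ∀ u : HeightOneSpectrum (𝓞 K), u.valuation K x ≤ 1) :
    ∃ y : 𝓞 K, algebraMap (𝓞 K) K y = x := by
  obtain ⟨y, hy⟩ := HeightOneSpectrum.mem_integers_of_valuation_le_one K x h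
  exact ⟨y, hy⟩

/-- An element of `K` all of whose finite valuations are `= 1` is a unit of `𝓞 K`. [folklore] -/
theorem Chevalley1951.exists_unit_eq_of_valuation_eq_one {x : K} (hx0 : x ≠ 0)
    (h : ∀ u : HeightOneSpectrum (𝓞 K), u.valuation K x = 1) :
    ∃ e : (𝓞 K)ˣ, algebraMap (𝓞 K) K (e : 𝓞 K) = x := by
  obtain ⟨y, hy⟩ := Chevalley1951.exists_ringOfIntegers_eq_of_valuation_le_one
    (x := x) fun u => (h u).le
  obtain ⟨z, hz⟩ := Chevalley1951.exists_ringOfIntegers_eq_of_valuation_le_one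
    (x := x⁻¹) fun u => by rw [map_inv₀, h u, inv_one]
  have hyz : y * z = 1 := by
    apply RingOfIntegers.coe_injective
    rw [map_mul, map_one, hy, hz, mul_inv_cancel₀ hx0]
  exact ⟨Units.mkOfMulEqOne y z hyz, hy⟩

/-- `|a⁻¹ - 1|_t = |a - 1|_t` for a `t`-adic unit `a`. [folklore] -/
theorem Chevalley1951.valuation_inv_sub_one {t : HeightOneSpectrum (𝓞 K)} {a : K}
    (ha : t.valuation K a = 1) : t.valuation K (a⁻¹ - 1) = t.valuation K (a - 1) := by
  have ha0 : a ≠ 0 := by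
    rintro rfl
    rw [map_zero] at ha
    exact zero_ne_one ha
  have h1 : a⁻¹ - 1 = -(a⁻¹ * (a - 1)) := by field_simp; ring
  rw [h1, Valuation.map_neg, map_mul, map_inv₀, ha, inv_one, one_mul]

/-- The valuation of a torsion element of `Kˣ` is `1`. [folklore] -/
theorem Chevalley1951.valuation_eq_one_of_mem_torsion (u : HeightOneSpectrum (𝓞 K)) {ξ : Kˣ}
    (hξ : ξ ∈ CommGroup.torsion Kˣ) : u.valuation K (ξ : K) = 1 := by
  rw [CommGroup.mem_torsion, isOfFinOrder_iff_pow_eq_one] at hξ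
  obtain ⟨N, hN, hξN⟩ := hξ
  have h1 : (u.valuation K (ξ : K)) ^ N = 1 := by
    rw [← map_pow, ← Units.val_pow_eq_pow_val, hξN, Units.val_one, map_one]
  exact (pow_eq_one_iff_left hN.ne').mp h1

/-- A torsion element of `Kˣ` is a root of unity of `𝓞 K`. [folklore] -/
theorem Chevalley1951.exists_torsion_eq_of_mem_torsion {ξ : Kˣ} (hξ : ξ ∈ CommGroup.torsion Kˣ) :
    ∃ ξ₀ : (𝓞 K)ˣ, ξ₀ ∈ Units.torsion K ∧ algebraMap (𝓞 K) K (ξ₀ : 𝓞 K) = ξ := by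
  obtain ⟨ξ₀, hξ₀⟩ := Chevalley1951.exists_unit_eq_of_valuation_eq_one ξ.ne_zero
    fun u => Chevalley1951.valuation_eq_one_of_mem_torsion u hξ
  refine ⟨ξ₀, ?_, hξ₀⟩
  rw [CommGroup.mem_torsion, isOfFinOrder_iff_pow_eq_one] at hξ
  obtain ⟨N, hN, hξN⟩ := hξ
  rw [Units.torsion, CommGroup.mem_torsion, isOfFinOrder_iff_pow_eq_one]
  refine ⟨N, hN, ?_⟩
  apply Units.ext
  apply RingOfIntegers.coe_injective
  rw [Units.val_pow_eq_pow_val, map_pow, hξ₀, ← Units.val_pow_eq_pow_val, hξN, Units.val_one,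
    Units.val_one, map_one]

omit [NumberField K] in
/-- **Fermat–Euler in `𝓞 K / I`**: a unit modulo `I` raised to `#(𝓞 K/I)ˣ` is `≡ 1 (mod I)`.
[folklore] -/
theorem Chevalley1951.pow_card_units_sub_one_mem (I : Ideal (𝓞 K)) [Finite (𝓞 K ⧸ I)] {y : 𝓞 K}
    (hy : IsUnit (Ideal.Quotient.mk I y)) : y ^ Nat.card (𝓞 K ⧸ I)ˣ - 1 ∈ I := by
  obtain ⟨yu, hyu⟩ := hy
  have h1 : yu ^ Nat.card (𝓞 K ⧸ I)ˣ = 1 := pow_card_eq_one'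
  rw [← Ideal.Quotient.eq_zero_iff_mem, map_sub, map_one, map_pow, ← hyu,
    ← Units.val_pow_eq_pow_val, h1, Units.val_one, sub_self]

/-- An element prime to `𝔭_w` is a unit modulo `𝔭_w^m`. [folklore] -/
theorem Chevalley1951.isUnit_mk_pow_of_notMem (w : HeightOneSpectrum (𝓞 K)) (m : ℕ) {y : 𝓞 K}
    (hy : y ∉ w.asIdeal) : IsUnit (Ideal.Quotient.mk (w.asIdeal ^ m) y) := by
  obtain ⟨a, i, hi, h⟩ := w.isMaximal.exists_inv hy
  have hsup : Ideal.span {y} ⊔ w.asIdeal = ⊤ := by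
    rw [Ideal.eq_top_iff_one]
    exact Ideal.mem_span_singleton_sup.mpr ⟨a, i, hi, h⟩
  have hsup' : Ideal.span {y} ⊔ w.asIdeal ^ m = ⊤ := Ideal.sup_pow_eq_top hsup
  obtain ⟨a', b, hb, h'⟩ := Ideal.mem_span_singleton_sup.mp
    ((Ideal.eq_top_iff_one _).mp hsup')
  refine IsUnit.of_mul_eq_one (Ideal.Quotient.mk _ a') ?_
  rw [← map_mul, ← map_one (Ideal.Quotient.mk (w.asIdeal ^ m)), ← h', map_add,
    Ideal.Quotient.eq_zero_iff_mem.mpr hb, add_zero, mul_comm]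

/-- `|r|_t < 1 ↔ r ∈ 𝔭_t` for an algebraic integer `r`. [folklore] -/
theorem Chevalley1951.valuation_algebraMap_lt_one_iff (t : HeightOneSpectrum (𝓞 K)) (r : 𝓞 K) :
    t.valuation K (algebraMap (𝓞 K) K r) < 1 ↔ r ∈ t.asIdeal := by
  rw [HeightOneSpectrum.valuation_of_algebraMap]
  exact t.intValuation_lt_one_iff_mem r

/-- Units of `𝓞 K` have valuation `1`. [folklore] -/
theorem Chevalley1951.valuation_algebraMap_unit (u : HeightOneSpectrum (𝓞 K)) (e : (𝓞 K)ˣ) :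
    u.valuation K (algebraMap (𝓞 K) K (e : 𝓞 K)) = 1 :=
  (HeightOneSpectrum.valuation_eq_one_iff_notMem u).mpr fun h =>
    u.isPrime.ne_top (Ideal.eq_top_of_isUnit_mem _ h e.isUnit)

/-- An element prime to `𝔭_w` is a unit modulo `𝔭_w`. [folklore] -/
theorem Chevalley1951.isUnit_mk_of_notMem (w : HeightOneSpectrum (𝓞 K)) {y : 𝓞 K}
    (hy : y ∉ w.asIdeal) : IsUnit (Ideal.Quotient.mk w.asIdeal y) := by
  have h := Chevalley1951.isUnit_mk_pow_of_notMem w 1 hy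
  rwa [pow_one] at h

end Valuation

/-! ### The structure of the `{v}`-units: `E = 𝓞_Kˣ · π₀^ℤ` -/

section VUnits

variable {K : Type*} [Field K] [NumberField K]

/-- **The `{v}`-units are `𝓞_Kˣ · π₀^ℤ`** (the `S`-unit theorem for `S = {v}`, elementary case):
there is a nonzero `π₀ ∈ 𝓞 K`, a unit at all finite places `≠ v`, such that every `x ∈ Kˣ` which
is a unit at all finite places `≠ v` is `x = e π₀^j` with `e ∈ 𝓞_Kˣ`, `j ∈ ℤ`.  Proof: the
`v`-orders of such `x` form a subgroup `hℤ` of `ℤ`; take `π₀` of order `|h|` (so `π₀ ∈ 𝓞 K`);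
then `x π₀^{-j}` has all its valuations `= 1`, hence is a unit. [folklore] -/
theorem Chevalley1951.exists_generator_vUnits (v : HeightOneSpectrum (𝓞 K)) :
    ∃ π₀ : 𝓞 K, algebraMap (𝓞 K) K π₀ ≠ 0 ∧
      (∀ u : HeightOneSpectrum (𝓞 K), u ≠ v → u.valuation K (algebraMap (𝓞 K) K π₀) = 1) ∧
      ∀ x : K, x ≠ 0 → (∀ u : HeightOneSpectrum (𝓞 K), u ≠ v → u.valuation K x = 1) →
        ∃ (e : (𝓞 K)ˣ) (j : ℤ),
          x = algebraMap (𝓞 K) K (e : 𝓞 K) * algebraMap (𝓞 K) K π₀ ^ j := by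
  -- the subgroup of `ℤ` of the `v`-orders of the `{v}`-units
  let H : AddSubgroup ℤ :=
    { carrier := {n | ∃ x : Kˣ,
        (∀ u : HeightOneSpectrum (𝓞 K), u ≠ v → u.valuation K (x : K) = 1) ∧
          Multiplicative.toAdd (v.valuationOfNeZero x) = n}
      zero_mem' := ⟨1, fun u _ => by rw [Units.val_one, map_one], by rw [map_one, toAdd_one]⟩
      add_mem' := by
        rintro a b ⟨x, hx, rfl⟩ ⟨y, hy, rfl⟩
        refine ⟨x * y, fun u hu => ?_, ?_⟩
        · rw [Units.val_mul, map_mul, hx u hu, hy u hu, one_mul]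
        · rw [map_mul, toAdd_mul]
      neg_mem' := by
        rintro a ⟨x, hx, rfl⟩
        refine ⟨x⁻¹, fun u hu => ?_, ?_⟩
        · rw [Units.val_inv_eq_inv_val, map_inv₀, hx u hu, inv_one]
        · rw [map_inv, toAdd_inv] }
  have hmemH : ∀ n : ℤ, n ∈ H ↔ ∃ x : Kˣ,
      (∀ u : HeightOneSpectrum (𝓞 K), u ≠ v → u.valuation K (x : K) = 1) ∧
        Multiplicative.toAdd (v.valuationOfNeZero x) = n := fun n => Iff.rfl
  obtain ⟨g, hg⟩ := Int.subgroup_cyclic H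
  -- the nonnegative generator `N = |g|`
  set N : ℤ := (g.natAbs : ℤ) with hNdef
  have hmem : ∀ n : ℤ, n ∈ H ↔ ∃ k : ℤ, k • N = n := by
    intro n
    rw [hg, ← AddSubgroup.zmultiples_eq_closure, ← Int.zmultiples_natAbs,
      AddSubgroup.mem_zmultiples_iff]
  -- `π₀` of `v`-order `-N`
  obtain ⟨π₁, hπ₁E, hπ₁g⟩ := (hmemH N).mp ((hmem N).mpr ⟨1, one_zsmul _⟩)
  set πu : Kˣ := π₁⁻¹ with hπudef
  have hπuE : ∀ u : HeightOneSpectrum (𝓞 K), u ≠ v → u.valuation K (πu : K) = 1 := fun u hu => by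
    rw [hπudef, Units.val_inv_eq_inv_val, map_inv₀, hπ₁E u hu, inv_one]
  have hπug : Multiplicative.toAdd (v.valuationOfNeZero πu) = -N := by
    rw [hπudef, map_inv, toAdd_inv, hπ₁g]
  have hval : ∀ x : Kˣ, v.valuation K (x : K) =
      WithZero.exp (Multiplicative.toAdd (v.valuationOfNeZero x)) := fun x => by
    rw [← HeightOneSpectrum.valuationOfNeZero_eq]
    rfl
  have hπuv : v.valuation K (πu : K) ≤ 1 := by
    rw [hval, hπug, ← WithZero.exp_zero, WithZero.exp_le_exp, hNdef]
    omega
  obtain ⟨π₀, hπ₀⟩ := Chevalley1951.exists_ringOfIntegers_eq_of_valuation_le_one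
    (x := (πu : K)) fun u => by
      by_cases hu : u = v
      · rw [hu]; exact hπuv
      · exact (hπuE u hu).le
  refine ⟨π₀, by rw [hπ₀]; exact πu.ne_zero, fun u hu => by rw [hπ₀]; exact hπuE u hu, ?_⟩
  intro x hx0 hxE
  set xu : Kˣ := Units.mk0 x hx0 with hxudef
  obtain ⟨k, hk⟩ := (hmem _).mp ((hmemH _).mpr ⟨xu, fun u hu => hxE u hu, rfl⟩)
  -- `e = x π₀^{-k}` has all valuations equal to `1`
  set eu : Kˣ := xu * πu ^ k with heudef
  have heuE : ∀ u : HeightOneSpectrum (𝓞 K), u ≠ v → u.valuation K (eu : K) = 1 := by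
    intro u hu
    rw [heudef, Units.val_mul, Units.val_zpow_eq_zpow_val, map_mul, map_zpow₀, hπuE u hu,
      one_zpow, mul_one]
    exact hxE u hu
  have heuv : v.valuation K (eu : K) = 1 := by
    rw [hval, heudef, map_mul, map_zpow, toAdd_mul, toAdd_zpow, hπug, ← hk, smul_eq_mul,
      smul_eq_mul, show k * N + k * -N = 0 by ring, WithZero.exp_zero]
  obtain ⟨e, he⟩ := Chevalley1951.exists_unit_eq_of_valuation_eq_one eu.ne_zero fun u => by
    by_cases hu : u = v
    · rw [hu]; exact heuv
    · exact heuE u hu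
  refine ⟨e, -k, ?_⟩
  rw [he, heudef, Units.val_mul, Units.val_zpow_eq_zpow_val, hπ₀, hxudef, Units.val_mk0,
    mul_assoc, ← zpow_add₀ πu.ne_zero, add_neg_cancel, zpow_zero, mul_one]

end VUnits

/-! ### A Frobenius at `𝔔 ∤ n` fixing `μ_n` fixes the `n`-th roots of integers `≡ 1 (mod 𝔔)` -/

section Frobenius

variable {K L : Type*} [Field K] [Field L] [Algebra K L]

/-- **Variant of `Chevalley1951.smul_eq_self_of_isArithFrobAt` for an algebraic integer `u`
prime to `𝔔`** (instead of a unit): if `σ` is an arithmetic Frobenius at the prime `𝔔 ∤ n` of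
`𝓞 L` fixing a primitive `n`-th root of unity `ζ ∈ 𝓞 L`, and `u ∈ 𝓞 K`, `u ∉ 𝔔`,
`u ≡ 1 (mod 𝔔 ∩ 𝓞 K)`, then `σ` fixes every `y ∈ 𝓞 L` with `y^n = u`.  Same computation
(Chevalley 1951, §5, p. 39): `n ∣ N𝔮 - 1`, `σ y ≡ y^{N𝔮} = y u^{(N𝔮-1)/n} ≡ y`, `σ y = ζ^i y`,
so `ζ^i ≡ 1 (mod 𝔔)` and `ζ^i = 1`. [cite: ChevalleyDeuxTheoremes1951, §5 (p. 39)] -/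
theorem Chevalley1951.smul_eq_self_of_isArithFrobAt' (Q : Ideal (𝓞 L)) [Q.IsPrime]
    {σ : L ≃ₐ[K] L} (hσ : IsArithFrobAt (𝓞 K) σ Q) {n : ℕ} (hn : (n : 𝓞 L) ∉ Q) {ζ : 𝓞 L}
    (hζ : IsPrimitiveRoot ζ n) (hσζ : σ • ζ = ζ) (u : 𝓞 K) (hu0 : u ∉ Q.under (𝓞 K))
    (hu : u - 1 ∈ Q.under (𝓞 K)) {y : 𝓞 L}
    (hy : y ^ n = algebraMap (𝓞 K) (𝓞 L) u) : σ • y = y := by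
  set q := Nat.card (𝓞 K ⧸ Q.under (𝓞 K)) with hqdef
  have hn0 : n ≠ 0 := by
    rintro rfl
    exact hn (by rw [Nat.cast_zero]; exact Q.zero_mem)
  haveI : NeZero n := ⟨hn0⟩
  -- `σ ζ = ζ ^ q = ζ`, so `n ∣ q - 1`
  have hζq : ζ ^ q = ζ := by
    have h := hσ.apply_of_pow_eq_one hζ.pow_eq_one hn
    rw [MulSemiringAction.toAlgHom_apply, hσζ] at h
    exact h.symm
  have hq1 : 1 ≤ q := hσ.card_pos
  have hndvd : n ∣ q - 1 := by
    rw [← hζ.pow_eq_one_iff_dvd]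
    have hζ0 : ζ ≠ 0 := hζ.ne_zero hn0
    have h2 : ζ ^ (q - 1) * ζ = 1 * ζ := by
      rw [← pow_succ, Nat.sub_add_cancel hq1, hζq, one_mul]
    exact mul_right_cancel₀ hζ0 h2
  obtain ⟨k, hk⟩ := hndvd
  -- `u ^ k ≡ 1 (mod 𝔔)`
  set u' : 𝓞 L := algebraMap (𝓞 K) (𝓞 L) u with hu'def
  have huQ : u' - 1 ∈ Q := by
    have h := Ideal.mem_comap.mp hu
    rwa [map_sub, map_one] at h
  have hu'Q : u' ∉ Q := fun h => hu0 (Ideal.mem_comap.mpr h)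
  have hukQ : u' ^ k - 1 ∈ Q :=
    Ideal.mem_of_dvd _ (by simpa using sub_dvd_pow_sub_pow u' 1 k) huQ
  -- `y ^ q - y ∈ 𝔔`
  have hyq : y ^ q - y ∈ Q := by
    have h1 : y ^ q = y * u' ^ k := by
      rw [← hy, ← pow_mul, ← hk, ← pow_succ', Nat.sub_add_cancel hq1]
    rw [h1, ← mul_sub_one]
    exact Q.mul_mem_left y hukQ
  -- hence `σ y - y ∈ 𝔔`
  have hσy : σ • y - y ∈ Q := by
    have h1 := hσ y
    rw [MulSemiringAction.toAlgHom_apply] at h1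
    have h2 := Q.add_mem h1 hyq
    rwa [sub_add_sub_cancel] at h2
  -- `y ∉ 𝔔`
  have hyQ : y ∉ Q := fun h => hu'Q (by rw [← hy]; exact Q.pow_mem_of_mem h n (Nat.pos_of_ne_zero hn0))
  -- `σ y = ζ^i y` with `(ζ^i)^n = 1`, computed in `L`
  set yL : L := algebraMap (𝓞 L) L y with hyLdef
  have hy0 : yL ≠ 0 := by
    rw [hyLdef, Ne, RingOfIntegers.coe_eq_zero_iff]
    rintro rfl
    exact hyQ Q.zero_mem
  have hζL : IsPrimitiveRoot (algebraMap (𝓞 L) L ζ) n :=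
    hζ.map_of_injective RingOfIntegers.coe_injective
  have hcoe : ∀ z : 𝓞 L, algebraMap (𝓞 L) L (σ • z) = σ (algebraMap (𝓞 L) L z) := fun z => rfl
  have hηn : (σ yL * yL⁻¹) ^ n = 1 := by
    have h1 : σ (yL ^ n) = yL ^ n := by
      have h2 : yL ^ n = algebraMap K L (algebraMap (𝓞 K) K u) := by
        rw [hyLdef, ← map_pow, hy, ← IsScalarTower.algebraMap_apply (𝓞 K) (𝓞 L) L,
          IsScalarTower.algebraMap_apply (𝓞 K) K L]
      rw [h2, AlgEquiv.commutes]
    rw [mul_pow, ← map_pow, h1, inv_pow, mul_inv_cancel₀ (pow_ne_zero _ hy0)]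
  obtain ⟨i, -, hi⟩ := hζL.eq_pow_of_pow_eq_one hηn
  have hσyL : σ yL = algebraMap (𝓞 L) L ζ ^ i * yL := by
    rw [hi, inv_mul_cancel_right₀ hy0]
  have hσy' : σ • y = ζ ^ i * y := by
    apply RingOfIntegers.coe_injective
    rw [hcoe, map_mul, map_pow]
    exact hσyL
  -- `ζ^i ≡ 1 (mod 𝔔)`, hence `ζ^i = 1`
  have h1 : ζ ^ i - 1 ∈ Q := by
    have h2 : (ζ ^ i - 1) * y ∈ Q := by rw [sub_mul, one_mul, ← hσy']; exact hσy
    exact (Ideal.IsPrime.mem_or_mem ‹_› h2).resolve_right hyQ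
  have hζi : ζ ^ i = 1 :=
    Chevalley1951.eq_one_of_pow_eq_one_of_sub_one_mem Q hn
      (by rw [← pow_mul, mul_comm, pow_mul, hζ.pow_eq_one, one_pow]) h1
  rw [hσy', hζi, one_mul]

end Frobenius

/-! ### An auxiliary place of large residue characteristic -/

section AuxPlace

variable {K : Type*} [Field K] [NumberField K]

/-- **A place of large residue characteristic off a finite set**: for a finite set `S` of finite
places and `B ∈ ℕ` there is a finite place `t ∉ S` whose prime ideal contains no rational integer
`0 < m ≤ B` (take `t` above a rational prime `ℓ > B` exceeding the norms of the places in `S`).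
[folklore] -/
theorem Chevalley1951.exists_place_forall_natCast_not_mem (S : Set (HeightOneSpectrum (𝓞 K)))
    (hS : S.Finite) (B : ℕ) :
    ∃ t : HeightOneSpectrum (𝓞 K), t ∉ S ∧ ∀ m : ℕ, 0 < m → m ≤ B → (m : 𝓞 K) ∉ t.asIdeal := by
  -- the product of the norms of the places of `S` is positive
  have hD : 0 < ∏ u ∈ hS.toFinset, Ideal.absNorm u.asIdeal := by
    refine Finset.prod_pos fun u _ => Nat.pos_of_ne_zero ?_
    rw [Ne, Ideal.absNorm_eq_zero_iff]
    exact u.ne_bot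
  -- a rational prime `ℓ > B + ∏ N u`
  obtain ⟨ℓ, hℓle, hℓ⟩ :=
    Nat.exists_infinite_primes (B + (∏ u ∈ hS.toFinset, Ideal.absNorm u.asIdeal) + 1)
  -- a prime `Q` of `𝓞 K` above `ℓ`
  have hmax : (Ideal.span {(ℓ : ℤ)}).IsMaximal :=
    ((Ideal.span_singleton_prime (by exact_mod_cast hℓ.ne_zero)).mpr
      (Nat.prime_iff_prime_int.mp hℓ)).isMaximal (by simpa using hℓ.ne_zero)
  haveI := hmax
  obtain ⟨Q, hQmax, hQover⟩ :=
    Ideal.exists_maximal_ideal_liesOver_of_isIntegral (S := 𝓞 K) (Ideal.span {(ℓ : ℤ)})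
  have hQbot : Q ≠ ⊥ :=
    Ring.ne_bot_of_isMaximal_of_not_isField hQmax (RingOfIntegers.not_isField K)
  -- rational integers in `Q` are multiples of `ℓ`
  have hdvd : ∀ m : ℕ, (m : 𝓞 K) ∈ Q → ℓ ∣ m := by
    intro m hm
    have h1 : (m : ℤ) ∈ Q.under ℤ := by
      rw [Ideal.under, Ideal.mem_comap, map_natCast]
      exact hm
    rw [← hQover.over, Ideal.mem_span_singleton] at h1
    exact Int.natCast_dvd_natCast.mp h1
  refine ⟨⟨Q, hQmax.isPrime, hQbot⟩, fun htS => ?_, fun m hm hmB hmem => ?_⟩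
  · -- `t ∈ S` would give `ℓ ∣ N t ∣ ∏ N u < ℓ`
    have h1 : ℓ ∣ Ideal.absNorm Q := hdvd (Ideal.absNorm Q) (Ideal.absNorm_mem Q)
    have h2 := Finset.dvd_prod_of_mem (fun u : HeightOneSpectrum (𝓞 K) => Ideal.absNorm u.asIdeal)
      (hS.mem_toFinset.mpr htS)
    have h3 := Nat.le_of_dvd hD (h1.trans h2)
    omega
  · have h1 : ℓ ≤ m := Nat.le_of_dvd hm (hdvd m hmem)
    omega

end AuxPlace

/-! ### Step 1: prime-power exponents, modulo roots of unity (Chevalley §5 and pp. 39–40) -/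

section PrimePow

variable {K : Type} [Field K] [NumberField K]

/-- **Chevalley's Théorème 1 for the `{v}`-units, prime-power exponent, modulo roots of unity**
(§5, p. 39, with the Chebotarev argument of pp. 39–40 and the descent of §4; the argument of
`Chevalley1951.exists_modulus_primePow` for `E = 𝓞_Kˣ · π₀^ℤ` instead of `𝓞_Kˣ`): for a finite
place `v` of the number field `K`, a prime `p`, `f ≥ 0` and a finite set `S` of finite places
there is a finite set `T` of finite places, off `S` and `v`, such that every algebraic integer
`x` which is a unit at all finite places `≠ v` and satisfies `x ≡ 1 (mod 𝔭_t)` for all `t ∈ T`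
lies in `μ(K) · (Kˣ)^{p^f}` (indeed `x = ± w^{p^{f+1}}`).  Proof: `n = p^{f+2}`, `L` the
splitting field of `(X^n - 1)(X^n - π₀) ∏_g (X^n - g)` over a generator of `μ(K)` and a
fundamental system of units, `ζ ∈ L` a primitive `n`-th root of unity; for each `σ ∈ Gal(L/K)`
a place `t_σ ∉ S ∪ {v} ∪ {u ∣ p}` with a prime `𝔔_σ ∣ t_σ` of `L` at which `σ` is a Frobenius
(Chebotarev); `T = {t_σ}`; if `x ≡ 1 (mod t_σ)` for all `σ`, every `σ ∈ Gal(L/K(ζ))` fixes an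
`n`-th root `y ∈ 𝓞_L` of `x`, so `y ∈ K(ζ)` and the weak Remarque gives `x = ± w^{p^{f+1}}`.
[cite: ChevalleyDeuxTheoremes1951, Thm 1, §5 (p. 39) and pp. 39–40] -/
theorem Chevalley1951.vUnits_exists_places_primePow (v : HeightOneSpectrum (𝓞 K)) {p : ℕ}
    (hp : p.Prime) (f : ℕ) {S : Set (HeightOneSpectrum (𝓞 K))} (hS : S.Finite) :
    ∃ T : Finset (HeightOneSpectrum (𝓞 K)), (∀ t ∈ T, t ∉ S ∧ t ≠ v) ∧
      ∀ x : 𝓞 K, algebraMap (𝓞 K) K x ≠ 0 →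
        (∀ u : HeightOneSpectrum (𝓞 K), u ≠ v → u.valuation K (algebraMap (𝓞 K) K x) = 1) →
        (∀ t ∈ T, x - 1 ∈ t.asIdeal) →
          ∃ (w ξ : Kˣ), ξ ∈ CommGroup.torsion Kˣ ∧
            algebraMap (𝓞 K) K x = (ξ : K) * (w : K) ^ p ^ f := by
  -- the exponent `n = p^t`, `t = f + 2`
  set t : ℕ := f + 2 with htdef
  set n : ℕ := p ^ t with hndef
  have hp0 : p ≠ 0 := hp.ne_zero
  have hn : 0 < n := pow_pos hp.pos t
  haveI : NeZero n := ⟨hn.ne'⟩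
  -- generators of the `{v}`-units: a generator `g₀` of `μ(K)`, a fundamental system, and `π₀`
  obtain ⟨π₀, hπ₀0, hπ₀E, hgen⟩ := Chevalley1951.exists_generator_vUnits (K := K) v
  obtain ⟨g₀, hg₀⟩ := IsCyclic.exists_generator (α := Units.torsion K)
  set cK : (𝓞 K)ˣ → K := fun g => algebraMap (𝓞 K) K (g : 𝓞 K) with hcKdef
  have hcK0 : ∀ g : (𝓞 K)ˣ, cK g ≠ 0 := fun g =>
    RingOfIntegers.coe_ne_zero_iff.mpr (Units.ne_zero g)
  set cπ : K := algebraMap (𝓞 K) K π₀ with hcπdef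
  -- the polynomial and its splitting field
  set P : K[X] := (X ^ n - 1) * ((X ^ n - C (cK g₀)) *
    ∏ i, (X ^ n - C (cK (Units.fundSystem K i)))) * (X ^ n - C cπ) with hPdef
  have hXn1 : (X ^ n - 1 : K[X]) ≠ 0 := by
    rw [← C_1]; exact X_pow_sub_C_ne_zero hn 1
  have hXnC : ∀ c : K, (X ^ n - C c : K[X]) ≠ 0 := fun c => X_pow_sub_C_ne_zero hn c
  have hP0 : P ≠ 0 := by
    rw [hPdef]
    refine mul_ne_zero (mul_ne_zero hXn1 (mul_ne_zero (hXnC _) ?_)) (hXnC _)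
    exact Finset.prod_ne_zero_iff.mpr fun i _ => hXnC _
  let L := P.SplittingField
  haveI : NumberField L := NumberField.of_module_finite K L
  haveI : PerfectField K := PerfectField.ofCharZero
  haveI : IsGalois K L := isGalois_iff.mpr ⟨inferInstance, inferInstance⟩
  haveI : Fintype (L ≃ₐ[K] L) := Fintype.ofFinite _
  have hsplit : (P.map (algebraMap K L)).Splits := SplittingField.splits P
  -- a primitive `n`-th root of unity `ζ ∈ L`
  obtain ⟨ζ, hζ⟩ : ∃ ζ : L, IsPrimitiveRoot ζ n := by
    have hdvd : Polynomial.cyclotomic n K ∣ P := by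
      rw [hPdef]
      exact ((Polynomial.cyclotomic.dvd_X_pow_sub_one n K).trans (dvd_mul_right _ _)).trans
        (dvd_mul_right _ _)
    have hdvd' : Polynomial.cyclotomic n L ∣ P.map (algebraMap K L) := by
      rw [← Polynomial.map_cyclotomic n (algebraMap K L)]
      exact Polynomial.map_dvd _ hdvd
    have hspl : (Polynomial.cyclotomic n L).Splits :=
      hsplit.of_dvd (Polynomial.map_ne_zero hP0) hdvd'
    have hdeg : (Polynomial.cyclotomic n L).degree ≠ 0 := by
      rw [Polynomial.degree_cyclotomic]
      exact_mod_cast (Nat.totient_pos.mpr hn).ne'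
    obtain ⟨ζ, hζ⟩ := hspl.exists_eval_eq_zero hdeg
    exact ⟨ζ, (Polynomial.isRoot_cyclotomic_iff_charZero hn).mp hζ⟩
  -- `n`-th roots of the generators, and of every unit, in `Lˣ`
  set φ : (𝓞 K)ˣ →* Lˣ := Units.map (algebraMap (𝓞 K) L : 𝓞 K →* L) with hφdef
  have hφval : ∀ g : (𝓞 K)ˣ, ((φ g : Lˣ) : L) = algebraMap K L (cK g) := fun g => by
    rw [hφdef, Units.coe_map, MonoidHom.coe_coe, hcKdef]
    exact (IsScalarTower.algebraMap_apply (𝓞 K) K L _)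
  have hrootc : ∀ c : K, c ≠ 0 → (X ^ n - C c) ∣ P →
      ∃ Y : Lˣ, (Y : L) ^ n = algebraMap K L c := by
    intro c hc hcP
    obtain ⟨y, hy⟩ := Chevalley1951.exists_pow_eq_of_dvd_of_splits hP0 hsplit hn hcP
    have hy0 : y ≠ 0 := by
      rintro rfl
      rw [zero_pow hn.ne'] at hy
      exact (map_ne_zero (algebraMap K L)).mpr hc hy.symm
    exact ⟨Units.mk0 y hy0, by rw [Units.val_mk0, hy]⟩
  have hrootφ : ∀ g : (𝓞 K)ˣ, (X ^ n - C (cK g)) ∣ P → ∃ Y : Lˣ, Y ^ n = φ g := by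
    intro g hg
    obtain ⟨Y, hY⟩ := hrootc (cK g) (hcK0 g) hg
    exact ⟨Y, Units.ext (by rw [Units.val_pow_eq_pow_val, hY, hφval])⟩
  have hroot₀ : ∃ Y : Lˣ, Y ^ n = φ (g₀ : (𝓞 K)ˣ) :=
    hrootφ _ (by
      rw [hPdef]
      exact ((dvd_mul_right _ _).trans (dvd_mul_left _ _)).trans (dvd_mul_right _ _))
  have hrooti : ∀ i, ∃ Y : Lˣ, Y ^ n = φ (Units.fundSystem K i) := fun i =>
    hrootφ _ (by
      rw [hPdef]
      exact (((Finset.dvd_prod_of_mem (fun j => (X ^ n - C (cK (Units.fundSystem K j)) : K[X]))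
        (Finset.mem_univ i)).trans (dvd_mul_left _ _)).trans (dvd_mul_left _ _)).trans
          (dvd_mul_right _ _))
  have hrootu : ∀ u : (𝓞 K)ˣ, ∃ Y : Lˣ, Y ^ n = φ u := by
    intro u
    refine Chevalley1951.exists_pow_eq_of_generators φ n hroot₀ hrooti ?_
    obtain ⟨⟨ξ, e⟩, hu, -⟩ := Units.exist_unique_eq_mul_prod K u
    dsimp only at hu
    obtain ⟨k, hk⟩ := Subgroup.mem_zpowers_iff.mp (hg₀ ξ)
    refine ⟨k, e, ?_⟩
    rw [hu, ← hk, SubgroupClass.coe_zpow]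
  have hrootπ : ∃ Y : Lˣ, (Y : L) ^ n = algebraMap K L cπ :=
    hrootc cπ hπ₀0 (by rw [hPdef]; exact dvd_mul_left _ _)
  -- the field `K' = K(ζ)` and the group `H = Gal(L/K')`
  set K' : IntermediateField K L := K⟮ζ⟯ with hK'def
  set H : Subgroup (L ≃ₐ[K] L) := K'.fixingSubgroup with hHdef
  -- the finite set of places to avoid: `S`, `v` and the places above `p`
  set S' : Set (HeightOneSpectrum (𝓞 K)) := S ∪ {v} ∪ {u | (p : 𝓞 K) ∈ u.asIdeal} with hS'def
  have hpK0 : (p : 𝓞 K) ≠ 0 := by exact_mod_cast hp0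
  have hS'fin : S'.Finite := by
    refine (hS.union (Set.finite_singleton v)).union ?_
    refine (Ideal.finite_factors (I := Ideal.span {(p : 𝓞 K)})
      (by rw [Ne, Ideal.zero_eq_bot, Ideal.span_singleton_eq_bot]; exact hpK0)).subset ?_
    intro u hu
    exact (Ideal.dvd_span_singleton).mpr hu
  -- Chebotarev: for each `σ` a good place `vσ σ` and a prime `Q σ` of `𝓞 L` above it
  have hcheb := fun σ : L ≃ₐ[K] L =>
    Chevalley1951.exists_prime_absNorm_isArithFrobAt_not_mem σ hS'fin
  choose vσ hvS hvprime Q hQ hfrob using hcheb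
  have hvσS : ∀ σ, vσ σ ∉ S := fun σ h => hvS σ (Or.inl (Or.inl h))
  have hvσv : ∀ σ, vσ σ ≠ v := fun σ h => hvS σ (Or.inl (Or.inr h))
  have hpQ : ∀ σ, (n : 𝓞 L) ∉ Q σ := by
    intro σ hmem
    apply hvS σ
    right
    change (p : 𝓞 K) ∈ (vσ σ).asIdeal
    haveI := (hQ σ).1
    have h1 : (p : 𝓞 L) ∈ Q σ := by
      rw [hndef, Nat.cast_pow] at hmem
      exact Ideal.IsPrime.mem_of_pow_mem ‹_› t hmem
    have h2 : (p : 𝓞 K) ∈ (Q σ).under (𝓞 K) := by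
      rw [Ideal.under, Ideal.mem_comap, map_natCast]
      exact h1
    rwa [← (hQ σ).2.over] at h2
  -- the set of places `T`
  refine ⟨Finset.univ.image vσ, fun t ht => ?_, ?_⟩
  · obtain ⟨σ, -, rfl⟩ := Finset.mem_image.mp ht
    exact ⟨hvσS σ, hvσv σ⟩
  -- the main point
  intro x hx0 hxE hxT
  have hxT' : ∀ σ, x - 1 ∈ (vσ σ).asIdeal := fun σ =>
    hxT (vσ σ) (Finset.mem_image_of_mem vσ (Finset.mem_univ σ))
  set cx : K := algebraMap (𝓞 K) K x with hcxdef
  -- `x = e π₀^j`, and an `n`-th root `y` of `x` in `L`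
  obtain ⟨e, j, hxej⟩ := hgen cx hx0 hxE
  obtain ⟨Ye, hYe⟩ := hrootu e
  obtain ⟨Yπ, hYπ⟩ := hrootπ
  set y : L := (Ye : L) * ((Yπ : L) ^ j) with hydef
  have hyn : y ^ n = algebraMap K L cx := by
    have h1 : ((Ye : Lˣ) : L) ^ n = algebraMap K L (cK e) := by
      rw [← Units.val_pow_eq_pow_val, hYe, hφval]
    have h2 : ((Yπ : L) ^ j) ^ n = algebraMap K L cπ ^ j := by
      rw [← zpow_natCast, ← zpow_mul, mul_comm, zpow_mul, zpow_natCast, hYπ]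
    rw [hydef, mul_pow, h1, h2, hxej, map_mul, map_zpow₀]
  have hxL0 : algebraMap K L cx ≠ 0 := (_root_.map_ne_zero _).mpr hx0
  have hyint : IsIntegral ℤ y := by
    refine IsIntegral.of_pow hn ?_
    rw [hyn, hcxdef]
    exact (RingOfIntegers.isIntegral_coe x).algebraMap
  set yO : 𝓞 L := ⟨y, hyint⟩ with hyOdef
  have hyOn : yO ^ n = algebraMap (𝓞 K) (𝓞 L) x := by
    apply RingOfIntegers.coe_injective
    rw [map_pow]
    change y ^ n = algebraMap (𝓞 L) L (algebraMap (𝓞 K) (𝓞 L) x)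
    rw [hyn, hcxdef, ← IsScalarTower.algebraMap_apply, ← IsScalarTower.algebraMap_apply]
  -- `ζ` as an algebraic integer
  have hζint : IsIntegral ℤ ζ := hζ.isIntegral hn
  set ζO : 𝓞 L := ⟨ζ, hζint⟩ with hζOdef
  have hζO : IsPrimitiveRoot ζO n :=
    IsPrimitiveRoot.of_map_of_injective (f := algebraMap (𝓞 L) L)
      (by exact hζ) RingOfIntegers.coe_injective
  -- every `σ ∈ H` fixes `y`
  have hfix : ∀ σ ∈ H, σ y = y := by
    intro σ hσ
    have hσζ : σ ζ = ζ :=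
      (IntermediateField.mem_fixingSubgroup_iff _ _).mp hσ ζ
        (IntermediateField.mem_adjoin_simple_self K ζ)
    have hσζO : σ • ζO = ζO := by
      apply RingOfIntegers.coe_injective
      exact hσζ
    haveI := (hQ σ).1
    have hx1Q : x - 1 ∈ (Q σ).under (𝓞 K) := by
      rw [← (hQ σ).2.over]
      exact hxT' σ
    have hx0Q : x ∉ (Q σ).under (𝓞 K) := by
      rw [← (hQ σ).2.over]
      exact (HeightOneSpectrum.valuation_eq_one_iff_notMem (K := K) (vσ σ)).mp (hxE (vσ σ) (hvσv σ))
    have h := Chevalley1951.smul_eq_self_of_isArithFrobAt' (Q σ) (hfrob σ) (hpQ σ) hζO hσζO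
      x hx0Q hx1Q hyOn
    have h' := congrArg (algebraMap (𝓞 L) L) h
    exact h'
  -- hence `y ∈ K(ζ)`
  have hyK' : y ∈ K' := by
    rw [hK'def, ← IsGalois.fixedField_fixingSubgroup K⟮ζ⟯, IntermediateField.mem_fixedField_iff]
    exact hfix
  -- the descent
  have hyx : ∃ y ∈ K⟮ζ⟯, y ^ p ^ t = algebraMap K L cx := ⟨y, hyK', by rw [← hndef]; exact hyn⟩
  obtain ⟨w, hw⟩ := Chevalley1951.exists_eq_pow_or_eq_neg_pow_of_mem_adjoin hp
    (by omega : 2 ≤ t) hζ hx0 hyx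
  have ht1 : t - 1 = f + 1 := by omega
  rw [ht1, pow_succ' p f, pow_mul] at hw
  have hw0 : w ^ p ≠ 0 := by
    intro h0
    rw [h0, zero_pow (pow_ne_zero f hp0), neg_zero, or_self] at hw
    exact hx0 hw
  have hneg1 : (-1 : Kˣ) ∈ CommGroup.torsion Kˣ := by
    rw [CommGroup.mem_torsion, isOfFinOrder_iff_pow_eq_one]
    exact ⟨2, two_pos, neg_one_sq⟩
  rcases hw with h | h
  · exact ⟨Units.mk0 (w ^ p) hw0, 1, one_mem _, by rw [Units.val_one, one_mul, Units.val_mk0, h]⟩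
  · exact ⟨Units.mk0 (w ^ p) hw0, -1, hneg1,
      by rw [Units.val_neg, Units.val_one, Units.val_mk0, h, neg_one_mul]⟩

end PrimePow

/-! ### Step 2: arbitrary exponents, modulo roots of unity (Chevalley §2) -/

section AnyExponent

variable {K : Type} [Field K] [NumberField K]

/-- **Chevalley's Théorème 1 for the `{v}`-units, arbitrary exponent, modulo roots of unity**
(§2: reduction to prime-power exponents, the sets of auxiliary places being united and the
conclusions combined by Bezout, `Chevalley1951.exists_torsion_mul_pow_of_coprime`): for `X > 0`
and a finite set `S` of finite places there is a finite set `T` of finite places off `S` and `v`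
such that every algebraic integer `x`, a unit at all finite places `≠ v`, with `x ≡ 1 (mod 𝔭_t)`
for all `t ∈ T`, lies in `μ(K) · (Kˣ)^X`. [cite: ChevalleyDeuxTheoremes1951, Thm 1, §2 (p. 37)] -/
theorem Chevalley1951.vUnits_exists_places_nat (v : HeightOneSpectrum (𝓞 K)) (X : ℕ) (hX : 0 < X)
    {S : Set (HeightOneSpectrum (𝓞 K))} (hS : S.Finite) :
    ∃ T : Finset (HeightOneSpectrum (𝓞 K)), (∀ t ∈ T, t ∉ S ∧ t ≠ v) ∧
      ∀ x : 𝓞 K, algebraMap (𝓞 K) K x ≠ 0 →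
        (∀ u : HeightOneSpectrum (𝓞 K), u ≠ v → u.valuation K (algebraMap (𝓞 K) K x) = 1) →
        (∀ t ∈ T, x - 1 ∈ t.asIdeal) →
          ∃ (w ξ : Kˣ), ξ ∈ CommGroup.torsion Kˣ ∧
            algebraMap (𝓞 K) K x = (ξ : K) * (w : K) ^ X := by
  induction X using Nat.recOnPosPrimePosCoprime with
  | zero => exact absurd hX (lt_irrefl 0)
  | one =>
    refine ⟨∅, fun t ht => absurd ht (Finset.notMem_empty t), fun x hx0 _ _ => ?_⟩
    exact ⟨Units.mk0 _ hx0, 1, one_mem _, by rw [Units.val_one, one_mul, pow_one, Units.val_mk0]⟩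
  | prime_pow p k hp hk => exact Chevalley1951.vUnits_exists_places_primePow v hp k hS
  | coprime A B hA hB hAB ihA ihB =>
    obtain ⟨T₁, hT₁, h₁⟩ := ihA (by omega)
    obtain ⟨T₂, hT₂, h₂⟩ := ihB (by omega)
    refine ⟨T₁ ∪ T₂, fun t ht => ?_, fun x hx0 hxE hxT => ?_⟩
    · rcases Finset.mem_union.mp ht with h | h
      · exact hT₁ t h
      · exact hT₂ t h
    obtain ⟨w₁, ξ₁, hξ₁, hx₁⟩ := h₁ x hx0 hxE fun t ht => hxT t (Finset.mem_union_left _ ht)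
    obtain ⟨w₂, ξ₂, hξ₂, hx₂⟩ := h₂ x hx0 hxE fun t ht => hxT t (Finset.mem_union_right _ ht)
    set u : Kˣ := Units.mk0 _ hx0 with hudef
    have hA' : ∃ (w ξ : Kˣ), ξ ∈ CommGroup.torsion Kˣ ∧ u = ξ * w ^ A :=
      ⟨w₁, ξ₁, hξ₁, Units.ext (by
        rw [hudef, Units.val_mk0, hx₁, Units.val_mul, Units.val_pow_eq_pow_val])⟩
    have hB' : ∃ (w ξ : Kˣ), ξ ∈ CommGroup.torsion Kˣ ∧ u = ξ * w ^ B :=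
      ⟨w₂, ξ₂, hξ₂, Units.ext (by
        rw [hudef, Units.val_mk0, hx₂, Units.val_mul, Units.val_pow_eq_pow_val])⟩
    obtain ⟨w, ξ, hξ, hu⟩ :=
      Chevalley1951.exists_torsion_mul_pow_of_coprime (CommGroup.torsion Kˣ) hAB hA' hB'
    refine ⟨w, ξ, hξ, ?_⟩
    have h := congrArg (fun z : Kˣ => (z : K)) hu
    simp only [hudef, Units.val_mk0, Units.val_mul, Units.val_pow_eq_pow_val] at h
    exact h

end AnyExponent

/-! ### Step 3: killing the roots of unity and reading off the depth -/

section Depth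

variable {K : Type} [Field K] [NumberField K]

/-- `|x - 1|_t ≤ q_t^{-1}` means `|x - 1|_t < 1`. [folklore] -/
theorem Chevalley1951.valuation_lt_one_of_le_exp_neg_one {t : HeightOneSpectrum (𝓞 K)} {x : K}
    (h : t.valuation K x ≤ WithZero.exp (-((1 : ℕ) : ℤ))) : t.valuation K x < 1 :=
  lt_of_le_of_lt h (by rw [← WithZero.exp_zero, WithZero.exp_lt_exp]; norm_num)

/-- **The final step for an integral representation** `z = ξ · w₀^{X c₀}`: if `ξ ∈ μ(K)`,
`w₀ ∈ 𝓞 K` is a unit at `t₀` and at `w`, `c₀ = #(𝓞 K/𝔭_{t₀})ˣ`, `X = #(𝓞 K/𝔭_w^m)ˣ`, the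
residue characteristic of `t₀` exceeds `#μ(K)` and `z ≡ 1 (mod 𝔭_{t₀})`, then
`z ≡ 1 (mod 𝔭_w^m)`: `w₀^{c₀} ≡ 1 (mod t₀)` forces `ξ ≡ 1 (mod t₀)`, hence `ξ = 1`
(`Chevalley1951.eq_one_of_pow_eq_one_of_sub_one_mem`), and `(w₀^{c₀})^X ≡ 1 (mod 𝔭_w^m)`.
(Chevalley's closing step, §3/p. 40, in the form of `Chevalley1951.thm1_units_holds`.)
[cite: ChevalleyDeuxTheoremes1951, Thm 1, proof pp. 39–40] -/
theorem Chevalley1951.valuation_sub_one_le_of_eq_torsion_mul_pow {t₀ w : HeightOneSpectrum (𝓞 K)}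
    (m : ℕ) [Finite (𝓞 K ⧸ w.asIdeal ^ m)] [Finite (𝓞 K ⧸ t₀.asIdeal)]
    (ht₀ : ((Units.torsionOrder K : ℕ) : 𝓞 K) ∉ t₀.asIdeal) {z : K} {ξ : Kˣ}
    (hξ : ξ ∈ CommGroup.torsion Kˣ) {w₀ : 𝓞 K} (hw₀t₀ : w₀ ∉ t₀.asIdeal) (hw₀w : w₀ ∉ w.asIdeal)
    (hz : z = (ξ : K) * algebraMap (𝓞 K) K w₀ ^
      (Nat.card (𝓞 K ⧸ w.asIdeal ^ m)ˣ * Nat.card (𝓞 K ⧸ t₀.asIdeal)ˣ))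
    (hzt₀ : t₀.valuation K (z - 1) < 1) :
    w.valuation K (z - 1) ≤ WithZero.exp (-(m : ℤ)) := by
  set X : ℕ := Nat.card (𝓞 K ⧸ w.asIdeal ^ m)ˣ with hXdef
  set c₀ : ℕ := Nat.card (𝓞 K ⧸ t₀.asIdeal)ˣ with hc₀def
  set cw : K := algebraMap (𝓞 K) K w₀ with hcwdef
  have hcwt₀ : t₀.valuation K cw = 1 :=
    (HeightOneSpectrum.valuation_eq_one_iff_notMem t₀).mpr hw₀t₀
  have hcw0 : cw ≠ 0 := by
    intro h0; rw [h0, map_zero] at hcwt₀; exact zero_ne_one hcwt₀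
  -- `w₀^{c₀} ≡ 1 (mod t₀)`, hence `w₀^{X c₀} ≡ 1 (mod t₀)`
  have h1 : w₀ ^ c₀ - 1 ∈ t₀.asIdeal :=
    Chevalley1951.pow_card_units_sub_one_mem t₀.asIdeal
      (Chevalley1951.isUnit_mk_of_notMem t₀ hw₀t₀)
  have h2 : w₀ ^ (X * c₀) - 1 ∈ t₀.asIdeal := by
    rw [pow_mul']
    exact Ideal.mem_of_dvd _ (by simpa using sub_dvd_pow_sub_pow (w₀ ^ c₀) 1 X) h1
  have h2' : t₀.valuation K (cw ^ (X * c₀) - 1) < 1 := by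
    rw [hcwdef, ← map_pow, ← map_one (algebraMap (𝓞 K) K), ← map_sub]
    exact (Chevalley1951.valuation_algebraMap_lt_one_iff t₀ _).mpr h2
  -- `ξ ≡ 1 (mod t₀)`
  have hξt₀ : t₀.valuation K ((ξ : K) - 1) < 1 := by
    have hN0 : cw ^ (X * c₀) ≠ 0 := pow_ne_zero _ hcw0
    have hξeq : (ξ : K) - 1 = (z - cw ^ (X * c₀)) * (cw ^ (X * c₀))⁻¹ := by
      rw [hz]; field_simp
    rw [hξeq, map_mul, map_inv₀, map_pow, hcwt₀, one_pow, inv_one, mul_one,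
      show z - cw ^ (X * c₀) = (z - 1) + (1 - cw ^ (X * c₀)) by ring]
    refine Valuation.map_add_lt _ hzt₀ ?_
    rwa [← Valuation.map_neg, neg_sub]
  -- hence `ξ = 1`
  obtain ⟨ξ₀, hξ₀tor, hξ₀⟩ := Chevalley1951.exists_torsion_eq_of_mem_torsion hξ
  have hξ₀1 : (ξ₀ : 𝓞 K) - 1 ∈ t₀.asIdeal := by
    rw [← Chevalley1951.valuation_algebraMap_lt_one_iff t₀, map_sub, map_one, hξ₀]
    exact hξt₀
  have hξ₀pow : ((ξ₀ : 𝓞 K)) ^ Units.torsionOrder K = 1 := by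
    have h3 : ξ₀ ∈ rootsOfUnity (Units.torsionOrder K) (𝓞 K) := by
      rw [Units.rootsOfUnity_eq_torsion]; exact hξ₀tor
    rw [mem_rootsOfUnity] at h3
    have h4 := congrArg (fun z : (𝓞 K)ˣ => (z : 𝓞 K)) h3
    simpa using h4
  have hξ₀eq : (ξ₀ : 𝓞 K) = 1 :=
    Chevalley1951.eq_one_of_pow_eq_one_of_sub_one_mem t₀.asIdeal ht₀ hξ₀pow hξ₀1
  have hξ1 : (ξ : K) = 1 := by rw [← hξ₀, hξ₀eq, map_one]
  -- the depth at `w`: `(w₀^{c₀})^X ≡ 1 (mod 𝔭_w^m)`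
  have hyw : w₀ ^ c₀ ∉ w.asIdeal := fun h => hw₀w (w.isPrime.mem_of_pow_mem c₀ h)
  have h5 : (w₀ ^ c₀) ^ X - 1 ∈ w.asIdeal ^ m :=
    Chevalley1951.pow_card_units_sub_one_mem (w.asIdeal ^ m)
      (Chevalley1951.isUnit_mk_pow_of_notMem w m hyw)
  have hzeq : z - 1 = algebraMap (𝓞 K) K ((w₀ ^ c₀) ^ X - 1) := by
    rw [hz, hξ1, one_mul, map_sub, map_one, map_pow, map_pow, ← pow_mul']
  rw [hzeq, HeightOneSpectrum.valuation_of_algebraMap]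
  exact (w.intValuation_le_pow_iff_mem _ m).mpr h5

/-- **Chevalley 1951, Théorème 1 for the `{v}`-units, congruence-depth form** (the hypothesis
`Chev` of `Automorphic.frobSatakeCompatibleAt_of_isPiOfArtinRep_both_of_chevalley`, as used by
Jacquet–Langlands 1970 in the proof of Lemma 12.5): for finite places `w ≠ v` of a number field
`K`, a finite set `S₀` of finite places and `m ∈ ℕ` there are a finite set `T` of finite places
disjoint from `S₀` and exponents `e` (here `e = 1`) such that every `x ∈ Kˣ` which is a unit at
all finite places `≠ v` and satisfies `|x - 1|_t ≤ q_t^{-e_t}` for all `t ∈ T` satisfies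
`|x - 1|_w ≤ q_w^{-m}`.  Proof: steps 1–3 of the module docstring (Chevalley's proof of Thm. 1 for
the finitely generated group `E = 𝓞_Kˣ · π₀^ℤ` of `{v}`-units with the exponent
`#(𝓞 K/𝔭_w^m)ˣ · #(𝓞 K/𝔭_{t₀})ˣ`; a non-integral `x`, or a non-integral `X c₀`-th root, is
replaced by its inverse). [cite: ChevalleyDeuxTheoremes1951, Thm 1 (p. 36), proof §§1–5 (pp. 36–40)]
[cite: JacquetLanglands1970, Lemma 12.5 (proof)] -/
theorem Chevalley1951.vUnits_valuation_sub_one_le (v w : HeightOneSpectrum (𝓞 K)) (hwv : w ≠ v)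
    (S₀ : Finset (HeightOneSpectrum (𝓞 K))) (m : ℕ) :
    ∃ (T : Finset (HeightOneSpectrum (𝓞 K))) (e : HeightOneSpectrum (𝓞 K) → ℕ),
      Disjoint T S₀ ∧ ∀ x : K, x ≠ 0 →
        (∀ u : HeightOneSpectrum (𝓞 K), u ≠ v → u.valuation K x = 1) →
        (∀ t ∈ T, t.valuation K (x - 1) ≤ WithZero.exp (-(e t : ℤ))) →
          w.valuation K (x - 1) ≤ WithZero.exp (-(m : ℤ)) := by
  -- the exponent `X = #(𝓞 K / 𝔭_w^m)ˣ`
  have hI : w.asIdeal ^ m ≠ ⊥ := pow_ne_zero m w.ne_bot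
  haveI : Finite (𝓞 K ⧸ w.asIdeal ^ m) := Ideal.finiteQuotientOfFreeOfNeBot _ hI
  set X : ℕ := Nat.card (𝓞 K ⧸ w.asIdeal ^ m)ˣ with hXdef
  have hX : 0 < X := Nat.card_pos
  -- the auxiliary place `t₀ ∉ S₀ ∪ {v, w}` of residue characteristic `> #μ(K)`
  obtain ⟨t₀, ht₀S, ht₀⟩ := Chevalley1951.exists_place_forall_natCast_not_mem
    ((S₀ : Set (HeightOneSpectrum (𝓞 K))) ∪ {v, w}) (S₀.finite_toSet.union (Set.toFinite _))
    (Units.torsionOrder K)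
  have ht₀S₀ : t₀ ∉ S₀ := fun h => ht₀S (Or.inl h)
  have ht₀v : t₀ ≠ v := fun h => ht₀S (Or.inr (Or.inl h))
  have ht₀w : t₀ ≠ w := fun h => ht₀S (Or.inr (Or.inr h))
  have htO : ((Units.torsionOrder K : ℕ) : 𝓞 K) ∉ t₀.asIdeal :=
    ht₀ _ (Units.torsionOrder_pos K) le_rfl
  haveI : Finite (𝓞 K ⧸ t₀.asIdeal) := Ideal.finiteQuotientOfFreeOfNeBot _ t₀.ne_bot
  set c₀ : ℕ := Nat.card (𝓞 K ⧸ t₀.asIdeal)ˣ with hc₀def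
  have hc₀ : 0 < c₀ := Nat.card_pos
  -- step 2 with exponent `X c₀`, avoiding `S₀ ∪ {w, t₀}` (and `v`)
  obtain ⟨T₁, hT₁, hmain⟩ := Chevalley1951.vUnits_exists_places_nat v (X * c₀) (Nat.mul_pos hX hc₀)
    (S := (S₀ : Set (HeightOneSpectrum (𝓞 K))) ∪ {w, t₀}) (S₀.finite_toSet.union (Set.toFinite _))
  have hT₁S₀ : ∀ t ∈ T₁, t ∉ S₀ := fun t ht h => (hT₁ t ht).1 (Or.inl h)
  have hT₁v : ∀ t ∈ T₁, t ≠ v := fun t ht => (hT₁ t ht).2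
  -- the structure of the `{v}`-units
  obtain ⟨π₀, hπ₀0, hπ₀E, hgen⟩ := Chevalley1951.exists_generator_vUnits (K := K) v
  refine ⟨insert t₀ T₁, fun _ => 1, ?_, ?_⟩
  · rw [Finset.disjoint_left]
    intro t ht
    rcases Finset.mem_insert.mp ht with rfl | ht
    · exact ht₀S₀
    · exact hT₁S₀ t ht
  -- integral representatives: an element or its inverse is `e π₀^k` with `k ≥ 0`
  have hint : ∀ y : K, y ≠ 0 → (∀ u : HeightOneSpectrum (𝓞 K), u ≠ v → u.valuation K y = 1) →
      ∃ y₀ : 𝓞 K, (∀ u : HeightOneSpectrum (𝓞 K), u ≠ v →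
        u.valuation K (algebraMap (𝓞 K) K y₀) = 1) ∧
        (algebraMap (𝓞 K) K y₀ = y ∨ algebraMap (𝓞 K) K y₀ = y⁻¹) := by
    intro y hy0 hyE
    obtain ⟨e, j, hyej⟩ := hgen y hy0 hyE
    rcases le_or_gt 0 j with hj | hj
    · refine ⟨(e : 𝓞 K) * π₀ ^ j.toNat, fun u hu => ?_, Or.inl ?_⟩
      · rw [map_mul, map_pow, map_mul, map_pow, Chevalley1951.valuation_algebraMap_unit, hπ₀E u hu,
          one_pow, mul_one]
      · rw [map_mul, map_pow, hyej, ← zpow_natCast, Int.toNat_of_nonneg hj]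
    · refine ⟨((e⁻¹ : (𝓞 K)ˣ) : 𝓞 K) * π₀ ^ (-j).toNat, fun u hu => ?_, Or.inr ?_⟩
      · rw [map_mul, map_pow, map_mul, map_pow, Chevalley1951.valuation_algebraMap_unit, hπ₀E u hu,
          one_pow, mul_one]
      · rw [map_mul, map_pow, hyej, mul_inv, ← zpow_natCast, Int.toNat_of_nonneg (by omega),
          zpow_neg, map_units_inv]
  -- the claim for an integral `{v}`-unit `z` congruent to `1` at `t₀` and on `T₁`
  have hclaim : ∀ z : 𝓞 K, algebraMap (𝓞 K) K z ≠ 0 →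
      (∀ u : HeightOneSpectrum (𝓞 K), u ≠ v → u.valuation K (algebraMap (𝓞 K) K z) = 1) →
      t₀.valuation K (algebraMap (𝓞 K) K z - 1) < 1 →
      (∀ t ∈ T₁, t.valuation K (algebraMap (𝓞 K) K z - 1) < 1) →
        w.valuation K (algebraMap (𝓞 K) K z - 1) ≤ WithZero.exp (-(m : ℤ)) := by
    intro z hz0 hzE hzt₀ hzT
    have hcong : ∀ t ∈ T₁, z - 1 ∈ t.asIdeal := fun t ht => by
      rw [← Chevalley1951.valuation_algebraMap_lt_one_iff t, map_sub, map_one]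
      exact hzT t ht
    obtain ⟨w', ξ, hξ, hzw⟩ := hmain z hz0 hzE hcong
    -- `w'` is a `{v}`-unit
    have hw'E : ∀ u : HeightOneSpectrum (𝓞 K), u ≠ v → u.valuation K (w' : K) = 1 := by
      intro u hu
      have h1 : (u.valuation K (w' : K)) ^ (X * c₀) = 1 := by
        have h2 := congrArg (u.valuation K) hzw
        rw [hzE u hu, map_mul, map_pow, Chevalley1951.valuation_eq_one_of_mem_torsion u hξ,
          one_mul] at h2
        exact h2.symm
      exact (pow_eq_one_iff_left (Nat.mul_pos hX hc₀).ne').mp h1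
    obtain ⟨w₀, hw₀E, hw₀⟩ := hint (w' : K) w'.ne_zero hw'E
    have hw₀t₀ : w₀ ∉ t₀.asIdeal :=
      (HeightOneSpectrum.valuation_eq_one_iff_notMem t₀).mp (hw₀E t₀ ht₀v)
    have hw₀w : w₀ ∉ w.asIdeal :=
      (HeightOneSpectrum.valuation_eq_one_iff_notMem w).mp (hw₀E w hwv)
    rcases hw₀ with hw₀ | hw₀
    · -- `w'` integral: finish with `z`
      exact Chevalley1951.valuation_sub_one_le_of_eq_torsion_mul_pow m htO hξ hw₀t₀ hw₀w
        (by rw [hw₀]; exact hzw) hzt₀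
    · -- `w'⁻¹` integral: finish with `z⁻¹`
      have hzt₀unit : t₀.valuation K (algebraMap (𝓞 K) K z) = 1 := hzE t₀ ht₀v
      have hzwunit : w.valuation K (algebraMap (𝓞 K) K z) = 1 := hzE w hwv
      have hinv : (algebraMap (𝓞 K) K z)⁻¹ =
          ((ξ⁻¹ : Kˣ) : K) * algebraMap (𝓞 K) K w₀ ^ (X * c₀) := by
        rw [hzw, hw₀, mul_inv, inv_pow, Units.val_inv_eq_inv_val]
      have h := Chevalley1951.valuation_sub_one_le_of_eq_torsion_mul_pow m htO (inv_mem hξ)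
        hw₀t₀ hw₀w hinv (by rw [Chevalley1951.valuation_inv_sub_one hzt₀unit]; exact hzt₀)
      rwa [Chevalley1951.valuation_inv_sub_one hzwunit] at h
  -- the main statement: apply the claim to `x` or to `x⁻¹`
  intro x hx0 hxE hxT
  have hxt₀ : t₀.valuation K (x - 1) < 1 :=
    Chevalley1951.valuation_lt_one_of_le_exp_neg_one (hxT t₀ (Finset.mem_insert_self t₀ T₁))
  have hxT₁ : ∀ t ∈ T₁, t.valuation K (x - 1) < 1 := fun t ht =>
    Chevalley1951.valuation_lt_one_of_le_exp_neg_one (hxT t (Finset.mem_insert_of_mem ht))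
  obtain ⟨x₀, hx₀E, hx₀⟩ := hint x hx0 hxE
  rcases hx₀ with hx₀ | hx₀
  · have h := hclaim x₀ (by rw [hx₀]; exact hx0) hx₀E (by rw [hx₀]; exact hxt₀)
      (fun t ht => by rw [hx₀]; exact hxT₁ t ht)
    rwa [hx₀] at h
  · have hxt₀unit : t₀.valuation K x = 1 := hxE t₀ ht₀v
    have hxwunit : w.valuation K x = 1 := hxE w hwv
    have h := hclaim x₀ (by rw [hx₀]; exact inv_ne_zero hx0) hx₀E
      (by rw [hx₀, Chevalley1951.valuation_inv_sub_one hxt₀unit]; exact hxt₀)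
      (fun t ht => by
        rw [hx₀, Chevalley1951.valuation_inv_sub_one (hxE t (hT₁v t ht))]; exact hxT₁ t ht)
    rwa [hx₀, Chevalley1951.valuation_inv_sub_one hxwunit] at h

end Depth

end Literature.NumberTheory.NumberFields
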